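import Mathlib
import HarnessLib
import Summits.Ventures.LatticeQCDFlow.Exactness.NCMCGeneralSpaceRestartChainSampleSize
import Summits.Ventures.LatticeQCDFlow.Exactness.NCMCGeneralSpaceDoeblinGeometric

/-!
# NCMCGeneralSpaceLaunchInterval — the `n_between` lever is GEOMETRIC: a one-sweep Doeblin constant
# `ε` by the invariant law becomes `1 − (1 − ε)^{m}` after `m` sweeps, so the certified sample-size
# penalty of correlated launches, `2/ε_m − 1`, tends to `1` geometrically in the launch interval

HONEST FRAMING: exact (Metropolis-corrected) sampling algorithms for lattice gauge theory;
figures of merit are autocorrelation/cost numbers at stated couplings and volumes; no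
continuum-physics claim.

Venture `LatticeQCDFlow` (cell pub-lqcd); FANOUT row 19 (`su2-snf`, GEN-8 — the row's `n_between`
lever).  OUR WORK (a residual-kernel induction; textbook, no source cited as a fact).  Row 8's
`Scoring/DoeblinSkeleton.doeblin_nHit_succ_of_doeblin` records that a one-step Doeblin constant is an
`m`-step constant; when the minorising law is the INVARIANT law `π` itself the constant IMPROVES:
writing `κ(x, ·) = ε·π + (1 − ε)·R(x, ·)` and using `π κ^m = π`,
`κ^{m+1}(x, B) = ε·π(B) + ∫ κ^{m}(y, B) (κ(x,dy) − ε π(dy)) ≥ ε·π(B) + (1 − ε)(1 − (1 − ε)^m)·π(B)`.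
(The Literature's Doeblin convergence `|κᵗ(x, A) − π(A)| ≤ (1 − ε)ᵗ` — Meyn–Tweedie 16.2.4, formalised in
`Literature/Probability/MarkovChains/Doeblin` — gives only `κᵗ(x, B) ≥ π(B) − (1 − ε)ᵗ`, weaker for small
`π(B)`; the multiplicative form below is what a variance-inflation constant needs.)

* (`doeblin_nHit_geometric` — `(1 − (1 − ε)^{m+1})·π(B) ≤ (nHit κ (m+1))(x, B)` under a one-step
  minorisation by the invariant law — lives in `Exactness/NCMCGeneralSpaceDoeblinGeometric`, GEN-9 split);
* **`CrooksPair.jarzynski_sampleSize_sufficient_restartChain_nHit_geometric`** — the restart chain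
  launched every `m + 1` sweeps of a one-sweep-minorised `ν₀`-invariant `κ₁` (`ε·π₀ ≤ κ₁(z, ·)`,
  `π₀ = Z₀⁻¹ν₀`, `0 < ε`): with `ε_m := 1 − (1 − ε)^{m+1}`,
  `E|Ẑ_N e^{ΔF} − 1| ≤ √(2/ε_m − 1)·e^{−t/4} + 2√(P_R-tail)` for `N ≥ exp(E_{P_R}[ΔF − W] + t)`.

Reading (value-free): the certified effective-sample-size penalty of launching every `n_between = m+1`
sweeps is `2/(1 − (1 − ε)^{m+1}) − 1 → 1` geometrically; doubling `n_between` from `m+1` to `2(m+1)`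
replaces `(1 − ε)^{m+1}` by its square.  NOT CLAIMED: a one-sweep Doeblin constant for any concrete
heat-bath / over-relaxation sweep (compact-group heat bath has one; its value is not ours to state).
-/

namespace Summit.Ventures.LatticeQCDFlow.Exactness.GeneralNCMC

open MeasureTheory ProbabilityTheory Set Filter Finset
open scoped ENNReal

/-! ## The restart chain launched every `m + 1` sweeps -/

variable {Ω E : Type*} [MeasurableSpace Ω] [MeasurableSpace E]

namespace CrooksPair

variable {ν₀ ν₁ : Measure Ω} {κF κR : Kernel Ω E} {s e : E → Ω} {W : E → ℝ}

/-- **THE `n_between` LEVER IS GEOMETRIC.**  Crooks pair; `ν₀`-invariant Markov `κ₁` with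
`ε·(Z₀⁻¹ν₀)(B) ≤ κ₁(z, B)`, `0 < ε`; launches every `m + 1` sweeps (`K = nHit κ₁ (m+1)`);
`N ≥ exp(E_{P_R}[ΔF − W] + t)`.  With `ε_m = 1 − (1 − ε)^{m+1}`:
`E|Ẑ_N e^{ΔF} − 1| ≤ √(2/ε_m − 1)·e^{−t/4} + 2√(P_R{E_{P_R}[ΔF − W] + t/2 < ΔF − W})`. -/
theorem jarzynski_sampleSize_sufficient_restartChain_nHit_geometric (κ₁ : Kernel Ω Ω)
    [IsMarkovKernel κ₁] [IsFiniteMeasure ν₀] [IsFiniteMeasure ν₁] [IsMarkovKernel κF]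
    [IsMarkovKernel κR] (h0 : ν₀ univ ≠ 0) (h1 : ν₁ univ ≠ 0) (hK : Kernel.Invariant κ₁ ν₀)
    (h : CrooksPair ν₀ ν₁ κF κR s e W) {ΔF : ℝ}
    (hΔF : Real.exp (-ΔF) = ((ν₀ univ)⁻¹ * ν₁ univ).toReal)
    {ε : ℝ≥0∞} (hε0 : 0 < ε)
    (hmin : ∀ z (B : Set Ω), MeasurableSet B → ε * ((ν₀ univ)⁻¹ • ν₀) B ≤ κ₁ z B) (m : ℕ)
    {N : ℕ} {t : ℝ} (hN : Real.exp ((∫ ε', (ΔF - W ε') ∂(fwdPathLaw ν₁ κR)) + t) ≤ N) :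
    haveI := isProbabilityMeasure_fwdPathLaw ν₀ h0 κF
    haveI := isMarkovKernel_nHit κ₁ (m + 1)
    ∫ x, |(1 / (N : ℝ)) * ∑ i ∈ range N, Real.exp (ΔF - W (x i)) - 1|
        ∂(Kernel.trajMeasure (X := fun _ : ℕ => E) (fwdPathLaw ν₀ κF)
          (fun n : ℕ => ((κF ∘ₖ nHit κ₁ (m + 1)).comap s h.measurable_s).comap
            (fun hh : (j : ↥(Finset.Iic n)) → E => hh ⟨n, Finset.mem_Iic.2 le_rfl⟩)
            (measurable_pi_apply _)))
      ≤ Real.sqrt (2 / (1 - (1 - ε) ^ (m + 1)).toReal - 1) * Real.exp (-t / 4)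
        + 2 * Real.sqrt ((fwdPathLaw ν₁ κR)
            {ε' | (∫ ε'', (ΔF - W ε'') ∂(fwdPathLaw ν₁ κR)) + t / 2 < ΔF - W ε'}).toReal := by
  haveI := isMarkovKernel_nHit κ₁ (m + 1)
  haveI : IsProbabilityMeasure ((ν₀ univ)⁻¹ • ν₀) := by
    constructor
    rw [Measure.smul_apply, smul_eq_mul, ENNReal.inv_mul_cancel h0 (measure_ne_top _ _)]
  have hπ₀ : Kernel.Invariant κ₁ ((ν₀ univ)⁻¹ • ν₀) := invariant_smul κ₁ hK _
  have hminK : ∀ z (B : Set Ω), MeasurableSet B →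
      (1 - (1 - ε) ^ (m + 1)) * ((ν₀ univ)⁻¹ • ν₀) B ≤ nHit κ₁ (m + 1) z B :=
    fun z B hB => doeblin_nHit_geometric (κ := κ₁) (π := (ν₀ univ)⁻¹ • ν₀) hπ₀
      (fun x B hB => hmin x B hB) m z hB
  have hεm : 0 < 1 - (1 - ε) ^ (m + 1) := by
    have hlt : (1 - ε) ^ (m + 1) < 1 := by
      have h1 : 1 - ε < 1 := ENNReal.sub_lt_self ENNReal.one_ne_top one_ne_zero hε0.ne'
      exact pow_lt_one₀ bot_le h1 (Nat.succ_ne_zero m)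
    exact tsub_pos_of_lt hlt
  exact h.jarzynski_sampleSize_sufficient_restartChain (nHit κ₁ (m + 1)) h0 h1 (invariant_nHit hK _)
    hΔF hεm hminK hN

end CrooksPair

end Summit.Ventures.LatticeQCDFlow.Exactness.GeneralNCMC
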